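import Mathlib
import Summits.NavierStokesRegularity.NavierStokesRegularity.Theorems.PoloidalWindowDoorPoloidalWindowRigidityZShockTurningShearDefinite

/-!
# Crux K2 `PoloidalWindowRigidity` (stmt-NavierStokesRegularity-19708), line `z_shock` — R3 inhabitant census: QUADRATIC SLICES
# WITH AN ARBITRARY STRUCTURE FUNCTION (IV) — definite quadratic-slice patterns of the autonomous height-evolution live on the
# linearly degenerate column

`--supports stmt-NavierStokesRegularity-19708 --as helper` (leafhand-ns-poloidalwindowdoor-3 g21, cell decomp-ns, 2026-09-01).  Class-free,
def-free; Mathlib + parts II–III (`…ZShockTurningShearQuadratic` p839549, `…ZShockTurningShearDefinite`).  **No stub and no summit is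
closed by this file; Navier–Stokes regularity is NOT proved here (rung 0).**

* ★ `quadSlice_posDef_TH`, `quadSlice_negDef_TH` — if a quadratic-slice pattern `W(s,y) = A + By₀ + Cy₁ + ½(Dy₀² + 2Ey₀y₁ + Gy₁²)` with
  positive (resp. negative) definite quadratic part AT EVERY HEIGHT solves the height-evolution `∂ₛ∂ₛW = γ(W)ΔW + γ'(W)|∇W|²` for a
  differentiable structure function `γ` (coefficients `D, G ∈ C²`, the others arbitrary — exactly the data of part II), then `γ' = 0` at
  EVERY attained value `W(s,y)`: the pattern lives on the linearly degenerate ((TH)) column; the family has no THICK member for ANY `γ`.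
  Proof: part III's single-height rigidity gives at each height an affine law for `γ` on the half-line `[m(s), ∞)`; these half-lines pairwise
  overlap, so ONE law `γ = γ₀ + 2μ·` holds on all attained values; substituting it turns the hypothesis into part II's `hpde` verbatim (at
  the bottom value `|∇W|² = 0`, so `γ'(m(s))` never enters), and part II's `quadSlice_flat_of_affine_thick` forces `D ≡ 0` unless `μ = 0` —
  contradicting definiteness; `γ'` at the bottom values by one-sided uniqueness (`deriv_eq_of_affine_Ici`).  The negative definite case is
  the mirror image under `W ↦ −W`, `γ ↦ γ(−·)`, which preserves the height-evolution.

What this adds to the census: the quadratic family — the simplest TWISTED non-affine polynomial family (its horizontal Hessian `Q(s)` may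
turn with the height) — has no member on the thick column for any differentiable structure function, as long as the quadratic part is
definite at every height; parts I–II needed `γ` affine.  Indefinite / rank-one quadratic parts: not treated (see part III).  Honest scope:
toy sub-family of R3 (`hGN` stays XL, not in print); kinematic (no NS).  presearch: as part III. [folklore]
-/

noncomputable section

namespace Summit.NavierStokesRegularity.NavierStokesRegularity.Theorems.PoloidalWindowDoorPoloidalWindowRigidityZShockTurningShearDefiniteHeights

-- the summit and its single sub-problem share the name (CONVENTIONS §1)
set_option linter.dupNamespace false

open Set Filter Topology
open Summit.NavierStokesRegularity.NavierStokesRegularity.Theorems.PoloidalWindowDoorPoloidalWindowRigidityZShockTurningShearQuadratic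
open Summit.NavierStokesRegularity.NavierStokesRegularity.Theorems.PoloidalWindowDoorPoloidalWindowRigidityZShockTurningShearDefinite

/-! ## All heights: definite quadratic-slice patterns live on the linearly degenerate column -/

/-- ★ **Positive definite quadratic-slice patterns are (TH).**  Let `γ` be differentiable (derivative `γ'`), `D, G ∈ C²(ℝ)` (derivatives
given pointwise), `A, B, C, E` and `A'', B'', C'', E''` arbitrary real functions — the data of part II.  Suppose the quadratic slice
`W(s,y) = A + By₀ + Cy₁ + ½(Dy₀² + 2Ey₀y₁ + Gy₁²)` has POSITIVE DEFINITE quadratic part at every height (`D > 0`, `DG − E² > 0`)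
and satisfies the height-evolution `∂ₛ∂ₛW = γ(W)ΔW + γ'(W)|∇W|²` with the structure function `γ`, i.e. `hpde` below for all
`s, y₀, y₁`.  Then `γ' = 0` at every attained value: the pattern lives on the linearly degenerate column (no THICK member).
Single-height rigidity at each height + overlap of the half-lines `[m(s), ∞)` + part II's `quadSlice_flat_of_affine_thick`. [folklore] -/
theorem quadSlice_posDef_TH {A B C D E G A'' B'' C'' D' G' D'' E'' G'' γ γ' : ℝ → ℝ}
    (hγ : ∀ t, HasDerivAt γ (γ' t) t)
    (hD : ∀ z, HasDerivAt D (D' z) z) (hD' : ∀ z, HasDerivAt D' (D'' z) z)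
    (hG : ∀ z, HasDerivAt G (G' z) z) (hG' : ∀ z, HasDerivAt G' (G'' z) z)
    (hpos : ∀ z, 0 < D z ∧ 0 < D z * G z - E z ^ 2)
    (hpde : ∀ z y₀ y₁ : ℝ,
      A'' z + B'' z * y₀ + C'' z * y₁ + (D'' z * y₀ ^ 2 + 2 * E'' z * y₀ * y₁ + G'' z * y₁ ^ 2) / 2 =
        γ (A z + B z * y₀ + C z * y₁ + (D z * y₀ ^ 2 + 2 * E z * y₀ * y₁ + G z * y₁ ^ 2) / 2) * (D z + G z) +
          γ' (A z + B z * y₀ + C z * y₁ + (D z * y₀ ^ 2 + 2 * E z * y₀ * y₁ + G z * y₁ ^ 2) / 2) *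
            ((B z + D z * y₀ + E z * y₁) ^ 2 + (C z + E z * y₀ + G z * y₁) ^ 2)) :
    ∀ z y₀ y₁, γ' (A z + B z * y₀ + C z * y₁ + (D z * y₀ ^ 2 + 2 * E z * y₀ * y₁ + G z * y₁ ^ 2) / 2) = 0 := by
  -- single-height rigidity at every height
  have hh : ∀ z, ∃ m γ₀ μ : ℝ,
      (∀ y₀ y₁, m ≤ A z + B z * y₀ + C z * y₁ + (D z * y₀ ^ 2 + 2 * E z * y₀ * y₁ + G z * y₁ ^ 2) / 2) ∧
      (∀ y₀ y₁, A z + B z * y₀ + C z * y₁ + (D z * y₀ ^ 2 + 2 * E z * y₀ * y₁ + G z * y₁ ^ 2) / 2 = m →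
        (B z + D z * y₀ + E z * y₁) ^ 2 + (C z + E z * y₀ + G z * y₁) ^ 2 = 0) ∧
      (∀ τ, 0 ≤ τ → γ (m + τ) = γ₀ + 2 * μ * (m + τ)) ∧ (∀ τ, 0 < τ → γ' (m + τ) = 2 * μ) := by
    intro z
    exact quadSlice_posDef_affine hγ
      (W := fun y₀ y₁ => A z + B z * y₀ + C z * y₁ + (D z * y₀ ^ 2 + 2 * E z * y₀ * y₁ + G z * y₁ ^ 2) / 2)
      (P := fun y₀ y₁ => (B z + D z * y₀ + E z * y₁) ^ 2 + (C z + E z * y₀ + G z * y₁) ^ 2)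
      (ℓ := fun y₀ y₁ => A'' z + B'' z * y₀ + C'' z * y₁ + (D'' z * y₀ ^ 2 + 2 * E'' z * y₀ * y₁ + G'' z * y₁ ^ 2) / 2)
      (fun _ _ => rfl) (fun _ _ => rfl) (fun _ _ => rfl) (hpos z).1 (hpos z).2 (fun y₀ y₁ => hpde z y₀ y₁)
  choose m γ₀ μ hlow hbot haff hder using hh
  -- one affine law on all the half-lines `[m z, ∞)`
  have hμ : ∀ z, μ z = μ 0 := by
    intro z
    have h1 := hder z (max (m z) (m 0) + 1 - m z) (by linarith [le_max_left (m z) (m 0)])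
    have h2 := hder 0 (max (m z) (m 0) + 1 - m 0) (by linarith [le_max_right (m z) (m 0)])
    have e1 : m z + (max (m z) (m 0) + 1 - m z) = max (m z) (m 0) + 1 := by ring
    have e2 : m 0 + (max (m z) (m 0) + 1 - m 0) = max (m z) (m 0) + 1 := by ring
    rw [e1] at h1
    rw [e2] at h2
    linarith
  have hγ₀ : ∀ z, γ₀ z = γ₀ 0 := by
    intro z
    have h1 := haff z (max (m z) (m 0) + 1 - m z) (by linarith [le_max_left (m z) (m 0)])
    have h2 := haff 0 (max (m z) (m 0) + 1 - m 0) (by linarith [le_max_right (m z) (m 0)])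
    have e1 : m z + (max (m z) (m 0) + 1 - m z) = max (m z) (m 0) + 1 := by ring
    have e2 : m 0 + (max (m z) (m 0) + 1 - m 0) = max (m z) (m 0) + 1 := by ring
    rw [e1] at h1
    rw [e2] at h2
    rw [hμ z] at h1
    linarith
  -- hence part II's hypothesis with `γ₀ 0`, `μ 0`
  have hpde' : ∀ z y₀ y₁ : ℝ,
      A'' z + B'' z * y₀ + C'' z * y₁ + (D'' z * y₀ ^ 2 + 2 * E'' z * y₀ * y₁ + G'' z * y₁ ^ 2) / 2 =
        (γ₀ 0 + 2 * μ 0 * (A z + B z * y₀ + C z * y₁ + (D z * y₀ ^ 2 + 2 * E z * y₀ * y₁ + G z * y₁ ^ 2) / 2)) *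
            (D z + G z) +
          2 * μ 0 * ((B z + D z * y₀ + E z * y₁) ^ 2 + (C z + E z * y₀ + G z * y₁) ^ 2) := by
    intro z y₀ y₁
    have hWge := hlow z y₀ y₁
    have hγW : γ (A z + B z * y₀ + C z * y₁ + (D z * y₀ ^ 2 + 2 * E z * y₀ * y₁ + G z * y₁ ^ 2) / 2) =
        γ₀ 0 + 2 * μ 0 * (A z + B z * y₀ + C z * y₁ + (D z * y₀ ^ 2 + 2 * E z * y₀ * y₁ + G z * y₁ ^ 2) / 2) := by
      have h1 := haff z (A z + B z * y₀ + C z * y₁ + (D z * y₀ ^ 2 + 2 * E z * y₀ * y₁ + G z * y₁ ^ 2) / 2 - m z)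
        (by linarith)
      rw [add_sub_cancel, hγ₀ z, hμ z] at h1
      exact h1
    have hγ'W : γ' (A z + B z * y₀ + C z * y₁ + (D z * y₀ ^ 2 + 2 * E z * y₀ * y₁ + G z * y₁ ^ 2) / 2) *
        ((B z + D z * y₀ + E z * y₁) ^ 2 + (C z + E z * y₀ + G z * y₁) ^ 2) =
        2 * μ 0 * ((B z + D z * y₀ + E z * y₁) ^ 2 + (C z + E z * y₀ + G z * y₁) ^ 2) := by
      rcases hWge.eq_or_lt with h | h
      · rw [hbot z y₀ y₁ h.symm, mul_zero, mul_zero]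
      · have h1 := hder z (A z + B z * y₀ + C z * y₁ + (D z * y₀ ^ 2 + 2 * E z * y₀ * y₁ + G z * y₁ ^ 2) / 2 - m z)
          (by linarith)
        rw [add_sub_cancel, hμ z] at h1
        rw [h1]
    rw [hpde z y₀ y₁, hγW, hγ'W]
  -- part II: a THICK affine law empties the family, so `μ 0 = 0`
  have hμ0 : μ 0 = 0 := by
    by_contra hne
    have h1 := (quadSlice_flat_of_affine_thick hne hD hD' hG hG' hpde' 0).1
    exact absurd h1 (hpos 0).1.ne'
  -- `γ` is constant on every `[m z, ∞)`; read off `γ'` at the attained values by one-sided uniqueness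
  intro z y₀ y₁
  have hWge := hlow z y₀ y₁
  refine deriv_eq_of_affine_Ici (hγ _) (γ₀ := γ₀ 0) (fun τ hτ => ?_)
  have h1 := haff z (A z + B z * y₀ + C z * y₁ + (D z * y₀ ^ 2 + 2 * E z * y₀ * y₁ + G z * y₁ ^ 2) / 2 + τ - m z)
    (by linarith)
  have e1 : m z + (A z + B z * y₀ + C z * y₁ + (D z * y₀ ^ 2 + 2 * E z * y₀ * y₁ + G z * y₁ ^ 2) / 2 + τ - m z) =
      A z + B z * y₀ + C z * y₁ + (D z * y₀ ^ 2 + 2 * E z * y₀ * y₁ + G z * y₁ ^ 2) / 2 + τ := by ring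
  rw [e1, hγ₀ z, hμ z, hμ0] at h1
  rw [h1]; ring

/-- **Negative definite quadratic-slice patterns are (TH)** — the mirror image of `quadSlice_posDef_TH` under `W ↦ −W`,
`γ ↦ γ(−·)` (which preserves the height-evolution): `D < 0`, `DG − E² > 0` at every height ⇒ `γ' = 0` at every attained value.
[folklore] -/
theorem quadSlice_negDef_TH {A B C D E G A'' B'' C'' D' G' D'' E'' G'' γ γ' : ℝ → ℝ}
    (hγ : ∀ t, HasDerivAt γ (γ' t) t)
    (hD : ∀ z, HasDerivAt D (D' z) z) (hD' : ∀ z, HasDerivAt D' (D'' z) z)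
    (hG : ∀ z, HasDerivAt G (G' z) z) (hG' : ∀ z, HasDerivAt G' (G'' z) z)
    (hneg : ∀ z, D z < 0 ∧ 0 < D z * G z - E z ^ 2)
    (hpde : ∀ z y₀ y₁ : ℝ,
      A'' z + B'' z * y₀ + C'' z * y₁ + (D'' z * y₀ ^ 2 + 2 * E'' z * y₀ * y₁ + G'' z * y₁ ^ 2) / 2 =
        γ (A z + B z * y₀ + C z * y₁ + (D z * y₀ ^ 2 + 2 * E z * y₀ * y₁ + G z * y₁ ^ 2) / 2) * (D z + G z) +
          γ' (A z + B z * y₀ + C z * y₁ + (D z * y₀ ^ 2 + 2 * E z * y₀ * y₁ + G z * y₁ ^ 2) / 2) *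
            ((B z + D z * y₀ + E z * y₁) ^ 2 + (C z + E z * y₀ + G z * y₁) ^ 2)) :
    ∀ z y₀ y₁, γ' (A z + B z * y₀ + C z * y₁ + (D z * y₀ ^ 2 + 2 * E z * y₀ * y₁ + G z * y₁ ^ 2) / 2) = 0 := by
  -- the reflected data
  have hγn : ∀ t, HasDerivAt (fun t => γ (-t)) (-γ' (-t)) t := by
    intro t
    have h := (hγ (-t)).comp t (hasDerivAt_neg t)
    simpa [Function.comp_def] using h
  have hDn : ∀ z, HasDerivAt (fun z => -D z) (-D' z) z := fun z => (hD z).fun_neg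
  have hD'n : ∀ z, HasDerivAt (fun z => -D' z) (-D'' z) z := fun z => (hD' z).fun_neg
  have hGn : ∀ z, HasDerivAt (fun z => -G z) (-G' z) z := fun z => (hG z).fun_neg
  have hG'n : ∀ z, HasDerivAt (fun z => -G' z) (-G'' z) z := fun z => (hG' z).fun_neg
  have hposn : ∀ z, 0 < -D z ∧ 0 < -D z * -G z - (-E z) ^ 2 := by
    intro z
    refine ⟨by linarith [(hneg z).1], ?_⟩
    have h : -D z * -G z - (-E z) ^ 2 = D z * G z - E z ^ 2 := by ring
    rw [h]; exact (hneg z).2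
  have hw : ∀ z y₀ y₁ : ℝ, -(-A z + -B z * y₀ + -C z * y₁ + (-D z * y₀ ^ 2 + 2 * -E z * y₀ * y₁ + -G z * y₁ ^ 2) / 2) =
      A z + B z * y₀ + C z * y₁ + (D z * y₀ ^ 2 + 2 * E z * y₀ * y₁ + G z * y₁ ^ 2) / 2 := fun _ _ _ => by ring
  have hp : ∀ z y₀ y₁ : ℝ, (-B z + -D z * y₀ + -E z * y₁) ^ 2 + (-C z + -E z * y₀ + -G z * y₁) ^ 2 =
      (B z + D z * y₀ + E z * y₁) ^ 2 + (C z + E z * y₀ + G z * y₁) ^ 2 := fun _ _ _ => by ring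
  have hpden : ∀ z y₀ y₁ : ℝ,
      -A'' z + -B'' z * y₀ + -C'' z * y₁ + (-D'' z * y₀ ^ 2 + 2 * -E'' z * y₀ * y₁ + -G'' z * y₁ ^ 2) / 2 =
        γ (-(-A z + -B z * y₀ + -C z * y₁ + (-D z * y₀ ^ 2 + 2 * -E z * y₀ * y₁ + -G z * y₁ ^ 2) / 2)) *
            (-D z + -G z) +
          -γ' (-(-A z + -B z * y₀ + -C z * y₁ + (-D z * y₀ ^ 2 + 2 * -E z * y₀ * y₁ + -G z * y₁ ^ 2) / 2)) *
            ((-B z + -D z * y₀ + -E z * y₁) ^ 2 + (-C z + -E z * y₀ + -G z * y₁) ^ 2) := by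
    intro z y₀ y₁
    rw [hw, hp]
    linear_combination (-1 : ℝ) * hpde z y₀ y₁
  intro z y₀ y₁
  have key := quadSlice_posDef_TH (A := fun z => -A z) (B := fun z => -B z) (C := fun z => -C z)
    (D := fun z => -D z) (E := fun z => -E z) (G := fun z => -G z)
    (A'' := fun z => -A'' z) (B'' := fun z => -B'' z) (C'' := fun z => -C'' z)
    (D' := fun z => -D' z) (G' := fun z => -G' z) (D'' := fun z => -D'' z) (E'' := fun z => -E'' z)
    (G'' := fun z => -G'' z) (γ := fun t => γ (-t)) (γ' := fun t => -γ' (-t))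
    hγn hDn hD'n hGn hG'n hposn hpden z y₀ y₁
  have key' : -γ' (-(-A z + -B z * y₀ + -C z * y₁ + (-D z * y₀ ^ 2 + 2 * -E z * y₀ * y₁ + -G z * y₁ ^ 2) / 2)) = 0 := key
  rw [hw] at key'
  exact neg_eq_zero.mp key'

end Summit.NavierStokesRegularity.NavierStokesRegularity.Theorems.PoloidalWindowDoorPoloidalWindowRigidityZShockTurningShearDefiniteHeights

end
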